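import Mathlib
import HarnessLib
import Summits.ABC.ABC.Theses.CongruentialReceptacle
import Literature.NumberTheory.EllipticCurves.SzpiroSixFifthsProofs

/-!
# Sketch — crux-ideate stmt-ABC-1725 (CompactBalanceTransfer), ideator 1, round 1

First-lemma signatures for idea card `cusp-weighted-receptacle`, plus the two small theorems the
card's diagnosis rests on:

* `formeForte_transfer_of_crux` — the crux DOMINATES the open implication
  "Szpiro (forme forte, for Frey curves of all triples) ⟹ abc": `CompactBalanceTransfer → FreySzpiroAll → ABC`
  (three lines from the route file's certified `closes`).
* `CuspWeightedReceptacle` — the tame-local ℤ/ℓⁿ receptacle with CUSP WEIGHTS (0,0,1) on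
  (v_p a, v_p b, v_p c): NO balance hypothesis; `CuspWeightedGlue : CuspWeightedReceptacle → ABC`
  is the congruence-to-equality reading (same proof shape as the proved
  `TameLocalReceptacleGivesTarget_proof`); `crux_of_cuspWeighted` records that the crux then follows with
  its hypothesis unused.
* `WeightedFreySzpiro α β γ` + `abcExponent_of_weighted` — the weight calculus: an archimedean-blind
  bound `a^α b^β c^γ ≤ C·rad^(6+ε)` (a ≤ b) buys abc with exponent `6/(β+γ)`; Szpiro (2,2,2) ↦ 3/2,
  Oesterlé's 2-isogenous curve (1,1,4) ↦ 6/5, cusp weights (0,β,6−β) ↦ 1.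
* `ArchSlotReceptacle` — variant: symmetric finite windows plus an INTEGER archimedean slot ⌊c₁·log j⌋.
-/

set_option linter.dupNamespace false

namespace Summit.ABC.ABC.Cruxes.CompactBalanceTransfer.SketchIdeator1

open Literature.NumberTheory.DiophantineGeometry
open Summit.ABC.ABC.Theses.CongruentialReceptacle

/-- Szpiro `6+ε` for the Frey curves of ALL abc-triples in elementary currency
(`(abc)² ≤ C·rad(abc)^(6+ε)`), i.e. Oesterlé's "forme forte" `|abc| ≤ C·rad^{3+ε/2}` — what an
archimedean-blind receptacle with symmetric weights delivers on every cell, not only the balanced one. -/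
def FreySzpiroAll : Prop :=
  ∀ ε : ℝ, 0 < ε → ∃ C : ℝ, ∀ a b c : ℕ, IsABCTriple a b c →
    ((a * b * c : ℕ) : ℝ) ^ 2 ≤ C * ((rad a b c : ℕ) : ℝ) ^ (6 + ε)

theorem balancedFreySzpiro_of_all (h : FreySzpiroAll) : BalancedFreySzpiro := by
  intro κ _ ε hε
  obtain ⟨C, hC⟩ := h ε hε
  exact ⟨C, fun a b c habc _ _ => hC a b c habc⟩

/-- The rev-7 deciding computation of the route, `BalancedFreySzpiro → CompactBalanceTransfer → ABC`
(Oesterlé 1988: known unconditionally only with exponents 3/2 resp. 6/5,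
`Literature.NumberTheory.EllipticCurves.abc_sixFifths_of_szpiro_holds`). -/
theorem abc_of_balancedFreySzpiro_of_transfer (hX : BalancedFreySzpiro) (hT : CompactBalanceTransfer) :
    _root_.ABC := by
  -- verbatim the rev-7 deciding theorem of the route (a, b ≥ κc ⇒ (abc)² ≥ κ⁴c⁶ ⇒ c < C′·rad^(1+ε)); kept here so
  -- that the Sketch depends on the three route definitions only (the rev-8 `closes` takes four items).
  apply hT
  intro κ hκ ε hε
  obtain ⟨C₀, hC₀⟩ := hX κ hκ (6 * ε) (by positivity)
  have hMpos : (0 : ℝ) < max C₀ 1 := lt_of_lt_of_le one_pos (le_max_right _ _)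
  have hκ4 : (0 : ℝ) < κ ^ 4 := by positivity
  have hMκ : (0 : ℝ) ≤ max C₀ 1 / κ ^ 4 := by positivity
  have hKnn : (0 : ℝ) ≤ (max C₀ 1 / κ ^ 4) ^ ((6 : ℕ) : ℝ)⁻¹ := Real.rpow_nonneg hMκ _
  have hK6 : ((max C₀ 1 / κ ^ 4) ^ ((6 : ℕ) : ℝ)⁻¹) ^ 6 = max C₀ 1 / κ ^ 4 :=
    Real.rpow_inv_natCast_pow hMκ (by norm_num)
  refine ⟨(max C₀ 1 / κ ^ 4) ^ ((6 : ℕ) : ℝ)⁻¹ + 1, ?_⟩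
  intro a b c habc ha hb
  have h := hC₀ a b c habc ha hb
  obtain ⟨ha0, hb0, hsum, _⟩ := habc
  have hRpos : (0 : ℝ) < ((Literature.NumberTheory.DiophantineGeometry.rad a b c : ℕ) : ℝ) := by
    have h0 : 0 < Literature.NumberTheory.DiophantineGeometry.rad a b c := by
      rw [Literature.NumberTheory.DiophantineGeometry.rad_def]
      exact Nat.pos_of_ne_zero UniqueFactorizationMonoid.radical_ne_zero
    exact_mod_cast h0
  have hRnn : (0 : ℝ) ≤ ((Literature.NumberTheory.DiophantineGeometry.rad a b c : ℕ) : ℝ) := hRpos.le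
  have hSpos : (0 : ℝ) < ((Literature.NumberTheory.DiophantineGeometry.rad a b c : ℕ) : ℝ) ^ (1 + ε) :=
    Real.rpow_pos_of_pos hRpos _
  have hS6 : ((Literature.NumberTheory.DiophantineGeometry.rad a b c : ℕ) : ℝ) ^ (6 + 6 * ε)
      = (((Literature.NumberTheory.DiophantineGeometry.rad a b c : ℕ) : ℝ) ^ (1 + ε)) ^ 6 := by
    rw [show (6 + 6 * ε : ℝ) = (1 + ε) * ((6 : ℕ) : ℝ) by push_cast; ring, Real.rpow_mul_natCast hRnn]
  have hc0' : 0 < c := by omega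
  have hc0 : (0 : ℝ) < (c : ℝ) := by exact_mod_cast hc0'
  have habc_cast : ((a * b * c : ℕ) : ℝ) = (a : ℝ) * (b : ℝ) * (c : ℝ) := by push_cast; ring
  have hκc : (0 : ℝ) ≤ κ * (c : ℝ) := by positivity
  have hlow : κ ^ 2 * (c : ℝ) ^ 3 ≤ (a : ℝ) * (b : ℝ) * (c : ℝ) := by
    have h1 : κ * (c : ℝ) * (κ * (c : ℝ)) ≤ (a : ℝ) * (b : ℝ) := mul_le_mul ha hb hκc (by positivity)
    calc κ ^ 2 * (c : ℝ) ^ 3 = (κ * (c : ℝ) * (κ * (c : ℝ))) * (c : ℝ) := by ring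
      _ ≤ (a : ℝ) * (b : ℝ) * (c : ℝ) := mul_le_mul_of_nonneg_right h1 hc0.le
  have hlow2 : κ ^ 4 * (c : ℝ) ^ 6 ≤ ((a * b * c : ℕ) : ℝ) ^ 2 := by
    rw [habc_cast]
    have h0 : (0 : ℝ) ≤ κ ^ 2 * (c : ℝ) ^ 3 := by positivity
    calc κ ^ 4 * (c : ℝ) ^ 6 = (κ ^ 2 * (c : ℝ) ^ 3) ^ 2 := by ring
      _ ≤ ((a : ℝ) * (b : ℝ) * (c : ℝ)) ^ 2 := pow_le_pow_left₀ h0 hlow 2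
  have hup : ((a * b * c : ℕ) : ℝ) ^ 2
      ≤ max C₀ 1 * (((Literature.NumberTheory.DiophantineGeometry.rad a b c : ℕ) : ℝ) ^ (1 + ε)) ^ 6 := by
    rw [← hS6]
    exact h.trans (mul_le_mul_of_nonneg_right (le_max_left _ _) (Real.rpow_nonneg hRnn _))
  have hc6 : (c : ℝ) ^ 6 ≤ ((max C₀ 1 / κ ^ 4) ^ ((6 : ℕ) : ℝ)⁻¹
      * ((Literature.NumberTheory.DiophantineGeometry.rad a b c : ℕ) : ℝ) ^ (1 + ε)) ^ 6 := by
    rw [mul_pow, hK6, div_mul_eq_mul_div, le_div_iff₀ hκ4]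
    calc (c : ℝ) ^ 6 * κ ^ 4 = κ ^ 4 * (c : ℝ) ^ 6 := by ring
      _ ≤ max C₀ 1 * (((Literature.NumberTheory.DiophantineGeometry.rad a b c : ℕ) : ℝ) ^ (1 + ε)) ^ 6 :=
        hlow2.trans hup
  have hcle : (c : ℝ) ≤ (max C₀ 1 / κ ^ 4) ^ ((6 : ℕ) : ℝ)⁻¹
      * ((Literature.NumberTheory.DiophantineGeometry.rad a b c : ℕ) : ℝ) ^ (1 + ε) :=
    le_of_pow_le_pow_left₀ (by norm_num) (mul_nonneg hKnn hSpos.le) hc6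
  calc (c : ℝ) ≤ (max C₀ 1 / κ ^ 4) ^ ((6 : ℕ) : ℝ)⁻¹
        * ((Literature.NumberTheory.DiophantineGeometry.rad a b c : ℕ) : ℝ) ^ (1 + ε) := hcle
    _ < ((max C₀ 1 / κ ^ 4) ^ ((6 : ℕ) : ℝ)⁻¹ + 1)
        * ((Literature.NumberTheory.DiophantineGeometry.rad a b c : ℕ) : ℝ) ^ (1 + ε) := by
      nlinarith [hSpos]

/-- DOMINANCE (checked): the crux implies "Szpiro forme forte (Frey curves) ⟹ abc". -/
theorem formeForte_transfer_of_crux (hT : CompactBalanceTransfer) : FreySzpiroAll → _root_.ABC :=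
  fun h => abc_of_balancedFreySzpiro_of_transfer (balancedFreySzpiro_of_all h) hT

/-- CUSP-WEIGHTED tame-local receptacle (card `cusp-weighted-receptacle`). Same typed shape as the
route's `TameLocalReceptacle` (integer table on the tame datum, windows of logarithmic size, sum over
`p ∣ abc` congruent mod `ℓⁿ` to a bounded `B`) with two changes: (i) NO balance hypothesis `κ`;
(ii) the LOWER window weights only the exponent of the SUM `c`: `c₁·(v_p(c) − 1 − ε)·log p ≤ t`
(so at `p ∣ ab` the floor is `−c₁(1+ε) log p`, blind to `v_p(a)`, `v_p(b)` beyond `p ∣ ab`).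
Summed, the floor is `c₁ (log c − (1+ε) log rad(abc))`: the archimedean size of `c` has been moved to
the finite places by the product formula `log c = Σ_p v_p(c) log p`. -/
def CuspWeightedReceptacle : Prop :=
  ∀ ε : ℝ, 0 < ε → ∃ c₁ c₁' c₃ : ℝ, 0 < c₁ ∧ ∃ m₀ : ℕ, ∀ ℓ n : ℕ, ℓ.Prime → 5 ≤ ℓ → m₀ ≤ ℓ ^ n →
    ∃ t : ℕ → ℕ → ℕ → ℕ → ℕ → ℕ → ℕ → ℤ,
      (∀ p i j k r s z : ℕ, p.Prime →
        c₁ * (((k : ℕ) : ℝ) - 1 - ε) * Real.log p ≤ (t p i j k r s z : ℝ) ∧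
        |(t p i j k r s z : ℝ)| ≤ c₁' * (((i + j + k : ℕ) : ℝ) + 1) * Real.log p) ∧
      ∀ a b c : ℕ, IsABCTriple a b c → ¬ ℓ ∣ a * b * c →
        ∃ B : ℤ, |(B : ℝ)| ≤ c₃ ∧
          (∑ p ∈ (a * b * c).primeFactors,
              t p (a.factorization p) (b.factorization p) (c.factorization p)
                (a / p ^ a.factorization p % p) (b / p ^ b.factorization p % p)
                (c / p ^ c.factorization p % p)) ≡ B [ZMOD ((ℓ ^ n : ℕ) : ℤ)]

/-- Glue (provable now, ~the proof of `TameLocalReceptacleGivesTarget_proof` with `log(abc)` replaced by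
`log c`): read at a prime `ℓ > abc` and `ℓⁿ > 2·max(Z, c₃) + 1` the congruence is an identity in `ℤ`, and the
summed lower window gives `c₁ (log c − (1+ε) log rad) ≤ c₃`, i.e. `c ≤ e^{c₃/c₁} rad^{1+ε}`. -/
def CuspWeightedGlue : Prop := CuspWeightedReceptacle → _root_.ABC

/-- The crux follows from the cusp-weighted receptacle with its hypothesis UNUSED (the card says so openly:
the archimedean partner is dissolved, not proved). -/
theorem crux_of_cuspWeighted (g : CuspWeightedGlue) (h : CuspWeightedReceptacle) :
    CompactBalanceTransfer := fun _ => g h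

/-- WEIGHT CALCULUS. An archimedean-blind bound of Szpiro type with weights `(α, β, γ)` on the ordered triple
`a ≤ b < c`: `a^α · b^β · c^γ ≤ C · rad(abc)^(6+ε)`. Frey curve: (2,2,2); its three ℚ-rational 2-isogenous
curves: (4,1,1), (1,4,1), (1,1,4) (Oesterlé 1988 §2 Remarque; Hindry, Arithmetics, Ch. 6 Rem. 5.13). -/
def WeightedFreySzpiro (α β γ : ℝ) : Prop :=
  ∀ ε : ℝ, 0 < ε → ∃ C : ℝ, ∀ a b c : ℕ, IsABCTriple a b c → a ≤ b →
    (a : ℝ) ^ α * (b : ℝ) ^ β * (c : ℝ) ^ γ ≤ C * ((rad a b c : ℕ) : ℝ) ^ (6 + ε)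

/-- abc with exponent `θ` (for every `ε`, `c ≤ C rad^(θ(1+ε))`). -/
def AbcExponent (θ : ℝ) : Prop :=
  ∀ ε : ℝ, 0 < ε → ∃ C : ℝ, ∀ a b c : ℕ, IsABCTriple a b c →
    (c : ℝ) ≤ C * ((rad a b c : ℕ) : ℝ) ^ (θ * (1 + ε))

/-- The calculus (provable now, elementary: `a ≥ 1`, `b ≥ c/2`): weights `(α,β,γ)` with `α, β, γ ≥ 0` buy
abc with exponent `6/(β+γ)`. Instances: (2,2,2) ↦ 3/2 (Oesterlé Prop. 1), (1,1,4) ↦ 6/5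
(`abc_sixFifths_of_szpiro_holds`), (0, β, 6−β) ↦ 1 = abc itself. Conversely under abc the bound with
weights of total `α+β+γ ≤ 6` is true, so `(0, β, 6−β)` is exactly the admissible abc-strength corner; every
elliptic curve over ℚ attached to the triple has `α ≥ 1` (bad reduction at `p ∣ a`), whence the floor 6/5 for
curve-borne archimedean-blind data. -/
def abcExponent_of_weighted : Prop :=
  ∀ α β γ : ℝ, 0 ≤ α → 0 ≤ β → 0 ≤ γ → 0 < β + γ →
    WeightedFreySzpiro α β γ → AbcExponent (6 / (β + γ))

/-- VARIANT (archimedean integer slot). Symmetric Szpiro windows at the finite primes PLUS one integer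
`tInf(a,b,c)` pinned to `c₁·log(c⁶/(abc)²) = c₁·log|j(E_{a,b})| + O(1)` — a function of `E/ℝ`, hence "local at
∞" although not a Galois-cohomological local term (`H¹(ℝ, finite)` is 2-torsion). Summed floor:
`c₁(2 log(abc) − (6+ε) log rad + 6 log c − 2 log(abc)) − c₃ = c₁(6 log c − (6+ε) log rad) − c₃`: modified
Szpiro, i.e. abc, again with no balance hypothesis. -/
def ArchSlotReceptacle : Prop :=
  ∀ ε : ℝ, 0 < ε → ∃ c₁ c₁' c₃ : ℝ, 0 < c₁ ∧ ∃ m₀ : ℕ, ∀ ℓ n : ℕ, ℓ.Prime → 5 ≤ ℓ → m₀ ≤ ℓ ^ n →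
    ∃ t : ℕ → ℕ → ℕ → ℕ → ℕ → ℕ → ℕ → ℤ, ∃ tInf : ℕ → ℕ → ℕ → ℤ,
      (∀ p i j k r s z : ℕ, p.Prime →
        c₁ * (2 * ((i + j + k : ℕ) : ℝ) - 6 - ε) * Real.log p ≤ (t p i j k r s z : ℝ) ∧
        |(t p i j k r s z : ℝ)| ≤ c₁' * (((i + j + k : ℕ) : ℝ) + 1) * Real.log p) ∧
      (∀ a b c : ℕ, 0 < a → 0 < b → 0 < c →
        c₁ * Real.log ((c : ℝ) ^ 6 / ((a * b * c : ℕ) : ℝ) ^ 2) - c₃ ≤ (tInf a b c : ℝ) ∧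
        (tInf a b c : ℝ) ≤ c₁' * (Real.log ((c : ℝ) ^ 6 / ((a * b * c : ℕ) : ℝ) ^ 2) + 1)) ∧
      ∀ a b c : ℕ, IsABCTriple a b c → ¬ ℓ ∣ a * b * c →
        ∃ B : ℤ, |(B : ℝ)| ≤ c₃ ∧
          ((∑ p ∈ (a * b * c).primeFactors,
              t p (a.factorization p) (b.factorization p) (c.factorization p)
                (a / p ^ a.factorization p % p) (b / p ^ b.factorization p % p)
                (c / p ^ c.factorization p % p)) + tInf a b c) ≡ B [ZMOD ((ℓ ^ n : ℕ) : ℤ)]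

/-- The two dissolutions are the same demand placed at different places: under the product formula the
cusp-weighted finite floor `Σ_p c₁(v_p c − 1 − ε) log p` and the symmetric floor plus archimedean slot differ
by the exact identity `6 log c − 2 log(abc) = log(c⁶/(abc)²)`; recorded as the statement that either
receptacle yields abc. -/
def ArchSlotGlue : Prop := ArchSlotReceptacle → _root_.ABC

end Summit.ABC.ABC.Cruxes.CompactBalanceTransfer.SketchIdeator1

namespace Summit.ABC.ABC.Cruxes.CompactBalanceTransfer.SketchIdeator1

open Literature.NumberTheory.DiophantineGeometry

/-- Swapping `a` and `b` preserves abc-triples. -/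
theorem isABCTriple_swap {a b c : ℕ} (h : IsABCTriple a b c) : IsABCTriple b a c := by
  obtain ⟨ha, hb, hab, hcop⟩ := h
  exact ⟨hb, ha, by omega, hcop.symm⟩

theorem rad_swap (a b c : ℕ) : rad b a c = rad a b c := by
  rw [rad_def, rad_def, Nat.mul_comm b a]

/-- THE WEIGHT CALCULUS, proved: weights `(α, β, γ) ≥ 0` on the ordered triple buy abc with exponent
`6/(β+γ)`. -/
theorem abcExponent_of_weighted_holds : abcExponent_of_weighted := by
  intro α β γ hα hβ hγ hs hW ε' hε'
  obtain ⟨C, hC⟩ := hW (6 * ε') (by positivity)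
  set s : ℝ := β + γ with hs_def
  -- constant: K^{1/s} with K = 2^β · max C 1
  set K : ℝ := (2 : ℝ) ^ β * max C 1 with hK_def
  have hKpos : 0 < K := by
    have h2 : (0 : ℝ) < (2 : ℝ) ^ β := Real.rpow_pos_of_pos (by norm_num) β
    have hM : (0 : ℝ) < max C 1 := lt_of_lt_of_le one_pos (le_max_right _ _)
    exact mul_pos h2 hM
  refine ⟨K ^ (1 / s), ?_⟩
  -- reduce to the ordered case a ≤ b
  suffices hmain : ∀ a b c : ℕ, IsABCTriple a b c → a ≤ b →
      (c : ℝ) ≤ K ^ (1 / s) * ((rad a b c : ℕ) : ℝ) ^ (6 / (β + γ) * (1 + ε')) by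
    intro a b c habc
    rcases le_total a b with hab | hba
    · exact hmain a b c habc hab
    · have h := hmain b a c (isABCTriple_swap habc) hba
      rwa [rad_swap] at h
  intro a b c habc hab
  obtain ⟨ha0, hb0, hsum, hcop⟩ := habc
  have h1 := hC a b c ⟨ha0, hb0, hsum, hcop⟩ hab
  -- positivity bookkeeping
  have hA1 : (1 : ℝ) ≤ (a : ℝ) := by exact_mod_cast ha0
  have hB0 : (0 : ℝ) ≤ (b : ℝ) := Nat.cast_nonneg b
  have hc0 : (0 : ℝ) ≤ (c : ℝ) := Nat.cast_nonneg c
  have hR1 : (1 : ℝ) ≤ ((rad a b c : ℕ) : ℝ) := by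
    have h0 : 0 < rad a b c := by
      rw [rad_def]; exact Nat.pos_of_ne_zero UniqueFactorizationMonoid.radical_ne_zero
    exact_mod_cast h0
  have hR0 : (0 : ℝ) ≤ ((rad a b c : ℕ) : ℝ) := le_trans zero_le_one hR1
  -- (c/2) ≤ b
  have hcb : (c : ℝ) / 2 ≤ (b : ℝ) := by
    have : (c : ℝ) = (a : ℝ) + (b : ℝ) := by exact_mod_cast hsum.symm
    have hab' : (a : ℝ) ≤ (b : ℝ) := by exact_mod_cast hab
    linarith
  have hc2 : (0 : ℝ) ≤ (c : ℝ) / 2 := by positivity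
  -- lower bound of the weighted product
  have hAα : (1 : ℝ) ≤ (a : ℝ) ^ α := Real.one_le_rpow hA1 hα
  have hBβ : ((c : ℝ) / 2) ^ β ≤ (b : ℝ) ^ β := Real.rpow_le_rpow hc2 hcb hβ
  have hCγ : (0 : ℝ) ≤ (c : ℝ) ^ γ := Real.rpow_nonneg hc0 γ
  have hprod : ((c : ℝ) / 2) ^ β * (c : ℝ) ^ γ ≤ (a : ℝ) ^ α * (b : ℝ) ^ β * (c : ℝ) ^ γ := by
    have h2 : (0 : ℝ) ≤ ((c : ℝ) / 2) ^ β := Real.rpow_nonneg hc2 β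
    calc ((c : ℝ) / 2) ^ β * (c : ℝ) ^ γ = 1 * (((c : ℝ) / 2) ^ β) * (c : ℝ) ^ γ := by ring
      _ ≤ (a : ℝ) ^ α * (b : ℝ) ^ β * (c : ℝ) ^ γ := by
          apply mul_le_mul_of_nonneg_right _ hCγ
          exact mul_le_mul hAα hBβ h2 (le_trans zero_le_one hAα)
  -- rewrite the left side as c^s / 2^β
  have hsplit : ((c : ℝ) / 2) ^ β * (c : ℝ) ^ γ = (c : ℝ) ^ s / (2 : ℝ) ^ β := by
    rw [Real.div_rpow hc0 (by norm_num : (0:ℝ) ≤ 2), hs_def, Real.rpow_add' hc0 (by linarith)]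
    ring
  -- upper side: C * R^(6+6ε') ≤ max C 1 * R^(6(1+ε'))
  have hup : C * ((rad a b c : ℕ) : ℝ) ^ (6 + 6 * ε') ≤
      max C 1 * ((rad a b c : ℕ) : ℝ) ^ (6 * (1 + ε')) := by
    have : (6 + 6 * ε' : ℝ) = 6 * (1 + ε') := by ring
    rw [this]
    exact mul_le_mul_of_nonneg_right (le_max_left _ _) (Real.rpow_nonneg hR0 _)
  have hcs : (c : ℝ) ^ s ≤ K * ((rad a b c : ℕ) : ℝ) ^ (6 * (1 + ε')) := by
    have h2pos : (0 : ℝ) < (2 : ℝ) ^ β := Real.rpow_pos_of_pos (by norm_num) β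
    have h := (hsplit ▸ hprod).trans (h1.trans hup)
    rw [div_le_iff₀ h2pos] at h
    calc (c : ℝ) ^ s ≤ max C 1 * ((rad a b c : ℕ) : ℝ) ^ (6 * (1 + ε')) * (2 : ℝ) ^ β := h
      _ = K * ((rad a b c : ℕ) : ℝ) ^ (6 * (1 + ε')) := by rw [hK_def]; ring
  -- take the s-th root
  have hsne : s ≠ 0 := ne_of_gt hs
  have hroot : (c : ℝ) = ((c : ℝ) ^ s) ^ (1 / s) := by
    rw [one_div, Real.rpow_rpow_inv hc0 hsne]
  have hmono : ((c : ℝ) ^ s) ^ (1 / s) ≤ (K * ((rad a b c : ℕ) : ℝ) ^ (6 * (1 + ε'))) ^ (1 / s) :=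
    Real.rpow_le_rpow (Real.rpow_nonneg hc0 s) hcs (by positivity)
  have hrhs : (K * ((rad a b c : ℕ) : ℝ) ^ (6 * (1 + ε'))) ^ (1 / s) =
      K ^ (1 / s) * ((rad a b c : ℕ) : ℝ) ^ (6 / (β + γ) * (1 + ε')) := by
    rw [Real.mul_rpow hKpos.le (Real.rpow_nonneg hR0 _), ← Real.rpow_mul hR0]
    congr 1
    rw [← hs_def]
    field_simp
  calc (c : ℝ) = ((c : ℝ) ^ s) ^ (1 / s) := hroot
    _ ≤ (K * ((rad a b c : ℕ) : ℝ) ^ (6 * (1 + ε'))) ^ (1 / s) := hmono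
    _ = K ^ (1 / s) * ((rad a b c : ℕ) : ℝ) ^ (6 / (β + γ) * (1 + ε')) := hrhs

end Summit.ABC.ABC.Cruxes.CompactBalanceTransfer.SketchIdeator1

namespace Summit.ABC.ABC.Cruxes.CompactBalanceTransfer.SketchIdeator1

open Literature.NumberTheory.DiophantineGeometry

/-- Congruence to equality (as in the landed glue file). -/
theorem congruenceToEquality' {m x y : ℤ} (h : x ≡ y [ZMOD m])
    (hx : 2 * |x| < m) (hy : 2 * |y| < m) : x = y := by
  have hd : m ∣ x - y := h.symm.dvd
  have habs : |x - y| < m := by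
    rw [abs_lt]
    constructor
    · linarith [le_abs_self x, neg_abs_le x, le_abs_self y, neg_abs_le y]
    · linarith [le_abs_self x, neg_abs_le x, le_abs_self y, neg_abs_le y]
  have h0 := Int.eq_zero_of_abs_lt_dvd hd habs
  linarith

/-- **The cusp-weighted glue, PROVED**: `CuspWeightedReceptacle → ABC`. The congruence-to-equality reading of
the landed `TameLocalReceptacleGivesTarget_proof`, with `Σ_p v_p(abc) log p = log(abc)` replaced by
`Σ_p v_p(c) log p = log c` (product formula for `c`) and no balance hypothesis anywhere. -/
theorem cuspWeightedGlue_holds : CuspWeightedGlue := by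
  intro hR
  refine (ABC_iff).mpr ?_
  intro ε hε
  obtain ⟨c₁, c₁', c₃, hc₁, m₀, H⟩ := hR ε hε
  refine ⟨Real.exp (c₃ / c₁) + 1, by positivity, ?_⟩
  intro a b c habc
  have ha0 : a ≠ 0 := Nat.pos_iff_ne_zero.mp habc.1
  have hb0 : b ≠ 0 := Nat.pos_iff_ne_zero.mp habc.2.1
  have hc0 : c ≠ 0 := by
    have := habc.2.2.1
    omega
  set N : ℕ := a * b * c with hN
  have hN0 : N ≠ 0 := mul_ne_zero (mul_ne_zero ha0 hb0) hc0
  have hcpos : (0 : ℝ) < (c : ℝ) := by exact_mod_cast Nat.pos_of_ne_zero hc0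
  have hRpos : (0 : ℝ) < ((rad a b c : ℕ) : ℝ) := by
    have h0 : 0 < rad a b c := by
      rw [rad_def]
      exact Nat.pos_of_ne_zero UniqueFactorizationMonoid.radical_ne_zero
    exact_mod_cast h0
  -- Σ_{p ∣ N} v_p(c) log p = log c  (the product formula for c, summed over the larger support of N)
  have hsub : c.primeFactors ⊆ N.primeFactors :=
    Nat.primeFactors_mono (dvd_mul_left c (a * b)) hN0
  have hlogC : ∑ p ∈ N.primeFactors, ((c.factorization p : ℕ) : ℝ) * Real.log p = Real.log c := by
    rw [Real.log_nat_eq_sum_factorization, Finsupp.sum, Nat.support_factorization]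
    symm
    refine Finset.sum_subset hsub ?_
    intro p hpN hpc
    have pp := Nat.prime_of_mem_primeFactors hpN
    have hndvd : ¬ p ∣ c := fun h => hpc (Nat.mem_primeFactors.mpr ⟨pp, h, hc0⟩)
    simp [Nat.factorization_eq_zero_of_not_dvd hndvd]
  have hlogR : ∑ p ∈ N.primeFactors, Real.log p = Real.log ((rad a b c : ℕ) : ℝ) := by
    rw [rad_def, ← hN, Nat.radical_eq_prod_primeFactors, Nat.cast_prod, Real.log_prod]
    intro p hp
    exact_mod_cast (Nat.prime_of_mem_primeFactors hp).ne_zero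
  -- the uniform a-priori bound Z on |Σ_p t(p; D_p)|
  set Z : ℝ := ∑ p ∈ N.primeFactors,
    c₁' * (((a.factorization p + b.factorization p + c.factorization p : ℕ) : ℝ) + 1) * Real.log p
    with hZ
  -- the modulus: a prime ℓ ≥ N + 5 and an exponent n with ℓ ^ n above everything
  obtain ⟨ℓ, hℓge, hℓp⟩ := Nat.exists_infinite_primes (N + 5)
  have h5 : 5 ≤ ℓ := by omega
  have hℓN : ¬ ℓ ∣ N := by
    intro h
    have := Nat.le_of_dvd (Nat.pos_of_ne_zero hN0) h
    omega
  set n : ℕ := m₀ + ⌈2 * Z⌉₊ + ⌈2 * c₃⌉₊ + 1 with hn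
  have hnlt : n < ℓ ^ n := Nat.lt_pow_self (by omega)
  have hm₀ : m₀ ≤ ℓ ^ n := by omega
  have hnR : 2 * Z < (n : ℝ) ∧ 2 * c₃ < (n : ℝ) := by
    rw [hn]
    push_cast
    constructor
    · linarith [Nat.le_ceil (2 * Z), Nat.le_ceil (2 * c₃), (Nat.cast_nonneg m₀ : (0 : ℝ) ≤ m₀),
        (Nat.cast_nonneg ⌈2 * c₃⌉₊ : (0 : ℝ) ≤ ⌈2 * c₃⌉₊)]
    · linarith [Nat.le_ceil (2 * Z), Nat.le_ceil (2 * c₃), (Nat.cast_nonneg m₀ : (0 : ℝ) ≤ m₀),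
        (Nat.cast_nonneg ⌈2 * Z⌉₊ : (0 : ℝ) ≤ ⌈2 * Z⌉₊)]
  have hpowR : (n : ℝ) < ((ℓ ^ n : ℕ) : ℝ) := by exact_mod_cast hnlt
  -- the table at modulus ℓ ^ n and the congruence for our triple
  obtain ⟨t, ht, hB⟩ := H ℓ n hℓp h5 hm₀
  obtain ⟨B, hBle, hcong⟩ := hB a b c habc hℓN
  set S : ℤ := ∑ p ∈ N.primeFactors, t p (a.factorization p) (b.factorization p) (c.factorization p)
    (a / p ^ a.factorization p % p) (b / p ^ b.factorization p % p) (c / p ^ c.factorization p % p)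
    with hS
  -- upper window: |S| ≤ Z
  have hSabs : |(S : ℝ)| ≤ Z := by
    rw [hS, Int.cast_sum, hZ]
    refine (Finset.abs_sum_le_sum_abs _ _).trans ?_
    exact Finset.sum_le_sum fun p hp => (ht p _ _ _ _ _ _ (Nat.prime_of_mem_primeFactors hp)).2
  -- lower window: c₁ (log c - (1 + ε) log rad) ≤ S
  have hSlow : ∑ p ∈ N.primeFactors,
      c₁ * (((c.factorization p : ℕ) : ℝ) - 1 - ε) * Real.log p ≤ (S : ℝ) := by
    rw [hS, Int.cast_sum]
    exact Finset.sum_le_sum fun p hp => (ht p _ _ _ _ _ _ (Nat.prime_of_mem_primeFactors hp)).1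
  have hlow_eq : ∑ p ∈ N.primeFactors, c₁ * (((c.factorization p : ℕ) : ℝ) - 1 - ε) * Real.log p
      = c₁ * (Real.log c - (1 + ε) * Real.log ((rad a b c : ℕ) : ℝ)) := by
    rw [← hlogC, ← hlogR, Finset.mul_sum, ← Finset.sum_sub_distrib, Finset.mul_sum]
    refine Finset.sum_congr rfl fun p _ => ?_
    ring
  -- congruence to equality: S = B, hence S ≤ c₃
  have hSlt : 2 * |S| < ((ℓ ^ n : ℕ) : ℤ) := by
    have h : 2 * |(S : ℝ)| < ((ℓ ^ n : ℕ) : ℝ) := by linarith [hnR.1]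
    exact_mod_cast h
  have hBlt : 2 * |B| < ((ℓ ^ n : ℕ) : ℤ) := by
    have h : 2 * |(B : ℝ)| < ((ℓ ^ n : ℕ) : ℝ) := by linarith [hnR.2]
    exact_mod_cast h
  have hSB : S = B := congruenceToEquality' hcong hSlt hBlt
  have hSle : (S : ℝ) ≤ c₃ := by
    rw [hSB]
    exact (le_abs_self _).trans hBle
  -- the height inequality log c ≤ (1 + ε) log rad + c₃ / c₁
  have hkey : c₁ * (Real.log c - (1 + ε) * Real.log ((rad a b c : ℕ) : ℝ)) ≤ c₃ := by
    rw [← hlow_eq]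
    exact hSlow.trans hSle
  have hkey' : Real.log c ≤ (1 + ε) * Real.log ((rad a b c : ℕ) : ℝ) + c₃ / c₁ := by
    have h : Real.log c - (1 + ε) * Real.log ((rad a b c : ℕ) : ℝ) ≤ c₃ / c₁ := by
      rw [le_div_iff₀ hc₁]
      linarith
    linarith
  -- exponentiate: c ≤ exp(c₃/c₁) · rad^(1+ε) < (exp(c₃/c₁) + 1) · rad^(1+ε)
  have hcle : (c : ℝ) ≤ Real.exp (c₃ / c₁) * ((rad a b c : ℕ) : ℝ) ^ (1 + ε) := by
    rw [Real.rpow_def_of_pos hRpos, ← Real.exp_add]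
    calc (c : ℝ) = Real.exp (Real.log c) := (Real.exp_log hcpos).symm
      _ ≤ Real.exp (c₃ / c₁ + Real.log ((rad a b c : ℕ) : ℝ) * (1 + ε)) :=
          Real.exp_le_exp.mpr (by linarith)
  have hSpos : (0 : ℝ) < ((rad a b c : ℕ) : ℝ) ^ (1 + ε) := Real.rpow_pos_of_pos hRpos _
  calc (c : ℝ) ≤ Real.exp (c₃ / c₁) * ((rad a b c : ℕ) : ℝ) ^ (1 + ε) := hcle
    _ < (Real.exp (c₃ / c₁) + 1) * ((rad a b c : ℕ) : ℝ) ^ (1 + ε) := by nlinarith [hSpos]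

/-- With the glue proved, the crux follows from the cusp-weighted receptacle ALONE (hypothesis unused). -/
theorem crux_of_cuspWeightedReceptacle (h : CuspWeightedReceptacle) :
    Summit.ABC.ABC.Theses.CongruentialReceptacle.CompactBalanceTransfer :=
  crux_of_cuspWeighted cuspWeightedGlue_holds h

end Summit.ABC.ABC.Cruxes.CompactBalanceTransfer.SketchIdeator1

namespace Summit.ABC.ABC.Cruxes.CompactBalanceTransfer.SketchIdeator1

open Literature.NumberTheory.DiophantineGeometry
open Literature.NumberTheory.EllipticCurves

/-- B–G 12.5.10 packaged with the DISCRIMINANT clause: every abc triple carries a global minimal Frey model `W₀`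
over `ℤ` with `cond ∣ 2¹⁰ rad(abc)` and `(abc)² ≤ 2⁸ |Δ(W₀)|` ((12.17): `Δ = 16(abc)²`; (12.18): `Δ = 2⁻⁸(abc)²`).
(Copy of `exists_minimal_frey_model` with the `c₄` clause replaced.) -/
theorem exists_minimal_frey_model_disc {a b c : ℕ} (h : IsABCTriple a b c) :
    ∃ W₀ : WeierstrassCurve ℤ, (W₀.baseChange ℚ).IsElliptic ∧
      (∀ v : IsDedekindDomain.HeightOneSpectrum ℤ, (W₀.baseChange ℚ).IsMinimalAt v) ∧
      (W₀.baseChange ℚ).conductorNorm ℤ ∣ 2 ^ 10 * rad a b c ∧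
      ((a * b * c : ℕ) : ℤ) ^ 2 ≤ 2 ^ 8 * |W₀.Δ| := by
  have h' := h
  obtain ⟨ha, hb, habc, hcop⟩ := h'
  have hc : 0 < c := by omega
  have habc0 : a * b * c ≠ 0 := by positivity
  by_cases h16 : 16 ∣ a * b * c
  · obtain ⟨A, B, hAB, hA, hB, hprod, -⟩ := exists_arrangement h h16
    have h0 : A * B * (A + B) ≠ 0 := by
      rw [← Int.natAbs_ne_zero, hprod]; exact habc0
    have h4 : 4 ∣ B - A - 1 := by
      have : B - A - 1 = B - (A + 1) := by ring
      rw [this]; exact dvd_sub (dvd_trans (by norm_num) hB) hA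
    have h16' : 16 ∣ A * B := dvd_mul_of_dvd_right hB _
    refine ⟨freyIntModel₂ A B, isElliptic_freyIntModel₂ h0 h4 h16', isMinimalAt_freyIntModel₂ hAB hA hB,
      ?_, ?_⟩
    · rw [rad_def, ← hprod]
      exact (conductorNorm_freyIntModel₂_dvd hAB h0 hA hB).trans (dvd_mul_left _ _)
    · rw [freyIntModel₂_Δ h4 h16']
      obtain ⟨e, he⟩ := h16'
      have he' : A * B / 16 = e := by rw [he]; simp
      have hcast : ((a * b * c : ℕ) : ℤ) ^ 2 = (A * B * (A + B)) ^ 2 := by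
        rw [← hprod, Int.natCast_natAbs, sq_abs]
      rw [hcast, he', show (A * B * (A + B)) ^ 2 = 2 ^ 8 * (e ^ 2 * (A + B) ^ 2) by rw [he]; ring,
        abs_of_nonneg (by positivity)]
  · have hab : IsCoprime (a : ℤ) (b : ℤ) := Nat.isCoprime_iff_coprime.mpr hcop
    have hP : (a : ℤ) * b * (a + b) = ((a * b * c : ℕ) : ℤ) := by rw [← habc]; push_cast; ring
    have h0 : (a : ℤ) * b * (a + b) ≠ 0 := by rw [hP]; exact_mod_cast habc0
    have h16' : ¬ (16 : ℤ) ∣ (a : ℤ) * b * (a + b) := by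
      rw [hP]; exact_mod_cast mt Int.natCast_dvd_natCast.mp h16
    refine ⟨freyIntModel a b, isElliptic_freyIntModel h0, isMinimalAt_freyIntModel hab h0 h16', ?_, ?_⟩
    · have := conductorNorm_freyIntModel_dvd hab h0 h16'
      rwa [hP, Int.natAbs_natCast, ← rad_def] at this
    · rw [freyIntModel_Δ, hP, abs_of_nonneg (by positivity)]
      nlinarith [sq_nonneg (((a * b * c : ℕ) : ℤ))]

/-- Szpiro's conjecture (tree decl, all `E/ℚ`) gives the forme-forte shape on Frey curves. -/
theorem freySzpiroAll_of_szpiro (hS : SzpiroConjecture) : FreySzpiroAll := by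
  intro ε hε
  obtain ⟨C₁, hC₁⟩ := hS ε hε
  set C : ℝ := max C₁ 1 with hCdef
  have hC0 : 0 ≤ C := le_trans zero_le_one (le_max_right _ _)
  refine ⟨2 ^ 8 * C * ((2 : ℝ) ^ 10) ^ (6 + ε), ?_⟩
  intro a b c h
  obtain ⟨W₀, hE, hmin, hN, hdisc⟩ := exists_minimal_frey_model_disc h
  haveI := hE
  have key := hC₁ (W₀.baseChange ℚ)
  rw [WeierstrassCurve.minimalDiscriminantNorm_eq_natAbs_holds W₀
      (WeierstrassCurve.Δ_ne_zero_of_isElliptic_baseChange_int W₀) hmin,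
    Nat.cast_natAbs, Int.cast_abs] at key
  set N : ℝ := (((W₀.baseChange ℚ).conductorNorm ℤ : ℕ) : ℝ) with hNdef
  set R : ℝ := ((rad a b c : ℕ) : ℝ) with hRdef
  have hN0 : 0 ≤ N := by positivity
  have hR0 : 0 ≤ R := by positivity
  have h1 : |(W₀.Δ : ℝ)| ≤ C * N ^ (6 + ε) :=
    key.trans (mul_le_mul_of_nonneg_right (le_max_left _ _) (by positivity))
  have h2 : N ≤ 2 ^ 10 * R := by
    have := Nat.le_of_dvd (mul_pos (by positivity)
      (by rw [rad_def]; exact Nat.radical_pos _)) hN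
    rw [hNdef, hRdef]; exact_mod_cast this
  have h3 : ((a * b * c : ℕ) : ℝ) ^ 2 ≤ 2 ^ 8 * |(W₀.Δ : ℝ)| := by exact_mod_cast hdisc
  have hε6 : (0 : ℝ) ≤ 6 + ε := by linarith
  calc ((a * b * c : ℕ) : ℝ) ^ 2 ≤ 2 ^ 8 * |(W₀.Δ : ℝ)| := h3
    _ ≤ 2 ^ 8 * (C * N ^ (6 + ε)) := by linarith
    _ ≤ 2 ^ 8 * (C * (2 ^ 10 * R) ^ (6 + ε)) := by gcongr
    _ = (2 ^ 8 * C * ((2 : ℝ) ^ 10) ^ (6 + ε)) * R ^ (6 + ε) := by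
        rw [Real.mul_rpow (by positivity) hR0]; ring

/-- **STRENGTH CERTIFICATE in terms of a named tree conjecture**: the crux converts Szpiro's conjecture into
abc — `CompactBalanceTransfer → SzpiroConjecture → ABC` — whereas unconditionally Szpiro is known to give only
exponent 6/5 (`abc_sixFifths_of_szpiro_holds`). -/
theorem crux_turns_szpiro_into_abc
    (hT : Summit.ABC.ABC.Theses.CongruentialReceptacle.CompactBalanceTransfer) (hS : SzpiroConjecture) :
    _root_.ABC :=
  formeForte_transfer_of_crux hT (freySzpiroAll_of_szpiro hS)

end Summit.ABC.ABC.Cruxes.CompactBalanceTransfer.SketchIdeator1
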